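import Summits.Ventures.PercRepro.RankLevelSetLevelNineQuart
import Summits.Ventures.PercRepro.RankLevelSetCoreNineLargeCorank
import Summits.Ventures.PercRepro.RankLevelSetCoreNineLargeCorankArith
import Summits.Ventures.PercRepro.RankLevelSetLevelNineQuartTailsA

/-!
# PercRepro — THE LEVEL-`10` INFRASTRUCTURE OF THE GXT CHAIN: the flat bound `f(10) ≤ 639`, the intersection cap
`ν_∩ ≤ 310`, the `Icc 3 11` sum, the tail doubling step and the mid-sum split at level `10` (p2, gen 35; a feeder for S4 — the top of the `q = 10` window, from `1,088`)

Every statement is the level-`10` instance of a level-`9` statement of the tree (p4 g15's `S4FlatBoundsSharp` /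
RankLevelSetLevelNinePartThree, p2 g34's RankLevelSetLevelNineQuartTailsA /
RankLevelSetCoreNineLargeCorank / RankLevelSetCoreNineLargeCorankArith), proved the same way:
* `ncard_le_six_thirty_nine_of_eRk_le_ten_of_free` — `f(10) ≤ 639 = 2·319 + 1` (night-1's doubling `ncard_le_two_mul_add_one_of_free`);
* `hinter_ten` — every rank-`≤ 9` set of the `e`-free core has `≤ r(X) + min 310 d` points (`319 = 9 + 310`);
* `sum_Icc_three_eleven_q` (`ThmN.Explicit.choose_ten_mul` is already in the tree);
* `mul_tailG_ten_le_of_base` — the level-`10` tail `G₁₀` from a base, any constants (every term at most doubles);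
* `sum_Ico_choose_add_sum_range_choose_le_ten` (the large-corank steps `largeTen_step_n` / `largeTen_step_p` are the
  companion module RankLevelSetLevelTenLargeStepsGXT).
Axioms: standard.
-/

set_option exponentiation.threshold 1024

open scoped Matroid

namespace PercRepro


namespace ThmN

open Set

variable {α : Type}

/-- `Σ_{k ∈ Icc 3 11} g k` written out. -/
theorem sum_Icc_three_eleven_q (g : ℕ → ℚ) :
    ∑ k ∈ Finset.Icc 3 11, g k = g 3 + g 4 + g 5 + g 6 + g 7 + g 8 + g 9 + g 10 + g 11 := by
  rw [show (11 : ℕ) = 10 + 1 from rfl, Finset.sum_Icc_succ_top (by norm_num), sum_Icc_three_ten_q]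

/-- `f(10) ≤ 639` on the `e`-free core (`639 = 2·319 + 1`). -/
theorem ncard_le_six_thirty_nine_of_eRk_le_ten_of_free (M : Matroid α) [M.Finite]
    (hfree : ∀ e ∈ M.E, ∃ A ⊆ M.E \ {e}, e ∉ M.closure A ∧ e ∉ M.closure ((M.E \ {e}) \ A)) :
    ∀ X ⊆ M.E, M.eRk X ≤ 10 → X.ncard ≤ 639 := by
  intro X hX hr
  have := ncard_le_two_mul_add_one_of_free M hfree (k := 9) (B := 319)
    (fun _ hY hrY => ncard_le_three_nineteen_of_eRk_le_nine_of_free M hfree _ hY (by exact_mod_cast hrY)) X hX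
    (by exact_mod_cast hr)
  omega

/-- **The intersection cap at level `10`**: every rank-`≤ 9` subset of the `e`-free core of corank `d` has at most
`r(X) + min 310 d` points (the flat bounds `1 / 3 / 6 / 10 / 19 / 39 / 79 / 159 / 319` and the nullity cap). -/
theorem hinter_ten (M : Matroid α) [M.Finite] {d : ℕ} (hd : M.E.encard = M.eRank + d)
    (hfree : ∀ e ∈ M.E, ∃ A ⊆ M.E \ {e}, e ∉ M.closure A ∧ e ∉ M.closure ((M.E \ {e}) \ A)) :
    ∀ X ⊆ M.E, M.eRk X ≤ ((10 - 1 : ℕ) : ℕ∞) → (X.ncard : ℕ∞) ≤ M.eRk X + (min 310 d : ℕ) := by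
  intro X hX hr
  obtain ⟨k, hk⟩ := Matroid.exists_eRk_eq_nat (M := M) hX
  rw [hk] at hr ⊢
  have hk9 : k ≤ 9 := by exact_mod_cast hr
  have hL0 : ∀ e ∈ M.E, ¬ M.IsLoop e := not_isLoop_of_free M hfree
  have hcap : X.ncard ≤ k + d := by
    have h1 := Matroid.encard_le_eRk_add_of_encard_eq hX hd
    rw [hk] at h1
    have hfin : X.Finite := M.ground_finite.subset hX
    rw [← hfin.cast_ncard_eq] at h1
    exact_mod_cast h1
  have h310 : X.ncard ≤ k + 310 := by
    rcases Nat.lt_or_ge k 5 with h | h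
    · have := ncard_add_one_le_two_pow_of_eRk_le M hL0 hfree k X hX (le_of_eq hk)
      interval_cases k <;> omega
    · rcases Nat.lt_or_ge k 6 with h' | h'
      · have hk' : k = 5 := by omega
        subst hk'
        have := ncard_le_nineteen_of_eRk_le_five_of_free M hfree hX (le_of_eq hk)
        omega
      · rcases Nat.lt_or_ge k 7 with h'' | h''
        · have hk' : k = 6 := by omega
          subst hk'
          have := ncard_le_thirtynine_of_eRk_le_six_of_free M hfree hX (le_of_eq hk)
          omega
        · rcases Nat.lt_or_ge k 8 with h''' | h'''
          · have hk' : k = 7 := by omega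
            subst hk'
            have := ncard_le_seventynine_of_eRk_le_seven_of_free M hfree X hX (le_of_eq hk)
            omega
          · rcases Nat.lt_or_ge k 9 with h'''' | h''''
            · have hk' : k = 8 := by omega
              subst hk'
              have := ncard_le_one_fifty_nine_of_eRk_le_eight_of_free M hfree X hX (le_of_eq hk)
              omega
            · have hk' : k = 9 := by omega
              subst hk'
              have := ncard_le_three_nineteen_of_eRk_le_nine_of_free M hfree X hX (le_of_eq hk)
              omega
  have hcard : X.ncard ≤ k + min 310 d := by omega
  exact_mod_cast hcard

/-- **The level-`10` tail from a base, any constants**: `a·G₁₀(d, n₀) ≤ b·2^n₀` with `20 ≤ n₀` gives `a·G₁₀(d, n) ≤ b·2^n` for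
every `n ≥ n₀` (every term of `G₁₀` at most doubles from `n` to `n + 1`). -/
theorem mul_tailG_ten_le_of_base (a b d n₀ : ℕ) (h20 : 20 ≤ n₀)
    (h : a * (n₀.choose 10 * 2 ^ (min 629 d) + n₀.choose 9 * 2 ^ 310 + n₀.choose 8 * 2 ^ 151 + n₀.choose 7 * 2 ^ 72 +
      n₀.choose 6 * 2 ^ 33 + n₀.choose 5 * 2 ^ 14 + n₀.choose 4 * 2 ^ 6 + n₀.choose 3 * 2 ^ 3 + n₀.choose 2 * 2 + n₀ + 1 +
      ∑ j ∈ Finset.range (d + 1), n₀.choose j) ≤ b * 2 ^ n₀)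
    (n : ℕ) (hn : n₀ ≤ n) :
    a * (n.choose 10 * 2 ^ (min 629 d) + n.choose 9 * 2 ^ 310 + n.choose 8 * 2 ^ 151 + n.choose 7 * 2 ^ 72 +
      n.choose 6 * 2 ^ 33 + n.choose 5 * 2 ^ 14 + n.choose 4 * 2 ^ 6 + n.choose 3 * 2 ^ 3 + n.choose 2 * 2 + n + 1 +
      ∑ j ∈ Finset.range (d + 1), n.choose j) ≤ b * 2 ^ n := by
  induction n, hn using Nat.le_induction with
  | base => exact h
  | succ n hn ih =>
    have h10 := choose_succ_le_two_mul_of_two_mul_le_cube n 10 (by omega)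
    have h9 := choose_succ_le_two_mul_of_two_mul_le_cube n 9 (by omega)
    have h8 := choose_succ_le_two_mul_of_two_mul_le_cube n 8 (by omega)
    have h7 := choose_succ_le_two_mul_of_two_mul_le_cube n 7 (by omega)
    have h6 := choose_succ_le_two_mul_of_two_mul_le_cube n 6 (by omega)
    have h5 := choose_succ_le_two_mul_of_two_mul_le_cube n 5 (by omega)
    have h4 := choose_succ_le_two_mul_of_two_mul_le_cube n 4 (by omega)
    have h3 := choose_succ_le_two_mul_of_two_mul_le_cube n 3 (by omega)
    have h2 := choose_succ_le_two_mul_of_two_mul_le_cube n 2 (by omega)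
    have hS := PercRepro.sum_choose_succ_le_two_mul n d
    have hpow : 2 ^ (n + 1) = 2 * 2 ^ n := by ring
    have hG : (n + 1).choose 10 * 2 ^ (min 629 d) + (n + 1).choose 9 * 2 ^ 310 + (n + 1).choose 8 * 2 ^ 151 + (n + 1).choose 7 * 2 ^ 72 +
        (n + 1).choose 6 * 2 ^ 33 + (n + 1).choose 5 * 2 ^ 14 + (n + 1).choose 4 * 2 ^ 6 + (n + 1).choose 3 * 2 ^ 3 +
        (n + 1).choose 2 * 2 + (n + 1) + 1 + ∑ j ∈ Finset.range (d + 1), (n + 1).choose j ≤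
        2 * (n.choose 10 * 2 ^ (min 629 d) + n.choose 9 * 2 ^ 310 + n.choose 8 * 2 ^ 151 + n.choose 7 * 2 ^ 72 + n.choose 6 * 2 ^ 33 +
          n.choose 5 * 2 ^ 14 + n.choose 4 * 2 ^ 6 + n.choose 3 * 2 ^ 3 + n.choose 2 * 2 + n + 1 +
          ∑ j ∈ Finset.range (d + 1), n.choose j) := by
      nlinarith [h10, h9, h8, h7, h6, h5, h4, h3, h2, hS, Nat.zero_le (2 ^ min 629 d)]
    calc a * ((n + 1).choose 10 * 2 ^ (min 629 d) + (n + 1).choose 9 * 2 ^ 310 + (n + 1).choose 8 * 2 ^ 151 + (n + 1).choose 7 * 2 ^ 72 +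
          (n + 1).choose 6 * 2 ^ 33 + (n + 1).choose 5 * 2 ^ 14 + (n + 1).choose 4 * 2 ^ 6 + (n + 1).choose 3 * 2 ^ 3 +
          (n + 1).choose 2 * 2 + (n + 1) + 1 + ∑ j ∈ Finset.range (d + 1), (n + 1).choose j)
        ≤ a * (2 * (n.choose 10 * 2 ^ (min 629 d) + n.choose 9 * 2 ^ 310 + n.choose 8 * 2 ^ 151 + n.choose 7 * 2 ^ 72 + n.choose 6 * 2 ^ 33 +
          n.choose 5 * 2 ^ 14 + n.choose 4 * 2 ^ 6 + n.choose 3 * 2 ^ 3 + n.choose 2 * 2 + n + 1 +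
          ∑ j ∈ Finset.range (d + 1), n.choose j)) := Nat.mul_le_mul_left _ hG
      _ = 2 * (a * (n.choose 10 * 2 ^ (min 629 d) + n.choose 9 * 2 ^ 310 + n.choose 8 * 2 ^ 151 + n.choose 7 * 2 ^ 72 + n.choose 6 * 2 ^ 33 +
          n.choose 5 * 2 ^ 14 + n.choose 4 * 2 ^ 6 + n.choose 3 * 2 ^ 3 + n.choose 2 * 2 + n + 1 +
          ∑ j ∈ Finset.range (d + 1), n.choose j)) := by ring
      _ ≤ 2 * (b * 2 ^ n) := Nat.mul_le_mul_left _ ih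
      _ = b * 2 ^ (n + 1) := by rw [hpow]; ring

/-- `Σ_{k ∈ Ico 10 p} C(n, k) + Σ_{j ≤ d} C(n, j) ≤ 2^n` for `n = p + d`. -/
theorem sum_Ico_choose_add_sum_range_choose_le_ten (p d : ℕ) :
    ∑ k ∈ Finset.Ico 10 p, (p + d).choose k + ∑ j ∈ Finset.range (d + 1), (p + d).choose j ≤ 2 ^ (p + d) := by
  have h1 : ∑ k ∈ Finset.Ico 10 p, (p + d).choose k ≤ ∑ k ∈ Finset.range p, (p + d).choose k := by
    rw [Finset.range_eq_Ico]
    exact Finset.sum_le_sum_of_subset (Finset.Ico_subset_Ico_left (by omega))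
  have h2 : ∑ j ∈ Finset.range (d + 1), (p + d).choose j = ∑ k ∈ Finset.Ico p (p + d + 1), (p + d).choose k := by
    rw [Finset.sum_Ico_eq_sum_range, show p + d + 1 - p = d + 1 by omega]
    rw [← Finset.sum_range_reflect]
    apply Finset.sum_congr rfl
    intro j hj
    rw [Finset.mem_range] at hj
    rw [show d + 1 - 1 - j = d - j by omega, ← Nat.choose_symm (show d - j ≤ p + d by omega),
      show p + d - (d - j) = p + j by omega]
  have h3 : ∑ k ∈ Finset.range p, (p + d).choose k + ∑ k ∈ Finset.Ico p (p + d + 1), (p + d).choose k =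
      2 ^ (p + d) := by
    rw [Finset.range_eq_Ico, Finset.sum_Ico_consecutive _ (by omega) (by omega), ← Finset.range_eq_Ico,
      Nat.sum_range_choose]
  omega

end ThmN

end PercRepro
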